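import Summits.BirchSwinnertonDyer.BirchSwinnertonDyer.Theorems.ByReductionTypeAtTwoOrdMissingLowerBoundAtTwoOfChildren
import Summits.BirchSwinnertonDyer.BirchSwinnertonDyer.Theorems.ByReductionTypeAtTwoKatoFreeSandwichImageSplit
import Summits.BirchSwinnertonDyer.BirchSwinnertonDyer.Theses.ByReductionTypeAtTwo
import Summits.BirchSwinnertonDyer.BirchSwinnertonDyer.Theses.TwoAdicConverse
import Summits.BirchSwinnertonDyer.BirchSwinnertonDyer.Theorems.GenusKolyvaginAtTwoCasselsTatePairingRat
import Summits.BirchSwinnertonDyer.BirchSwinnertonDyer.Theorems.ByReductionTypeAtTwoMultUpperHalfParity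
import HarnessLib

/-!
# TRIAGE r1 seat 2/2, GEN 19 — crux `OrdMissingLowerBoundAtTwo` (stmt-BirchSwinnertonDyer-19577, K4 `ByReductionTypeAtTwo`):
# rev-30 CURRENCY PROBE of the split (print bundle 23764 ∧ λ-half 19556 ⟹ 19577, glue 23765) + the 19420 re-pricing

Refuter crux-triage companion (crux WORKFILE; elaborates on the farm; no `sorry`; nothing proposed; no Literature fact;
no `@[route_item]`).  BSD is NOT proved by anything here; 19577 is NOT closed; this seat LEADS nothing and ran no
`ledger skeleton check`.  Purpose: the route file `Theses/ByReductionTypeAtTwo.lean` was re-rendered as **rev 30**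
(mtime 2026-08-29T00:13Z) after this seat's GEN 18 file (which priced rev 29).  The checks below certify BY KERNEL — not by
reading — that under rev 30

* (A) the glue item 23765 `OrdMissingLowerBoundAtTwoOfChildren` is still closed by the landed proof p676269
  (`KatoFreeSandwich.ordMissingLowerBoundAtTwoOfChildren_proof`), axioms ⊆ {propext, Classical.choice, Quot.sound};
* (B) the crux decl is still BY NAME the leaf `Theorems.OrdHalvesAtTwo.OrdMissingLowerBoundAtTwo` (`Iff.rfl`);
* (C) K4's child decl `OrdLambdaHalfAtTwo` (item 19556, verbatim text) is still DEFINITIONALLY the constant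
  `Theorems.TwoAdicTwistConverse.OrdLambdaHalfAtTwo` consumed by the line (p668589) AND the S3 route's own decl
  `Theses.TwoAdicConverse.OrdLambdaHalfAtTwo` (both `Iff.rfl`) — so a proof of 19556 filed against EITHER route spelling
  closes K4's child;
* (D) the print bundle 23764 is still the four-way conjunction PUB ∧ Cassels ∧ Abbes–Ullmo ∧ T2 (`Iff.rfl`);
* (E) the by-image re-assembly p671201 still has p668589's exact type (the two branch sockets `hΛirr` / `hΛred` of
  `ordMissingLowerBoundAtTwo_of_lambdaHalfIrr_of_lambdaHalfRed` are unchanged), so SUMMON key (c) «reducible GL₁ road of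
  19556 landed» still plugs into `missingLowerBoundAt_two_of_red_of_lambdaHalfRed` with the socket
  `∀ W, ¬CM → GoodOrd W 2 → ¬ E[2] irreducible → LambdaHalfAtTwo W` (rank-free; the rank-0 sub-socket suffices by this
  seat's GEN 14 companion `TRIAGE_r1_2_ImageSliceGen14.lean` §1);
* (F) K4 rev 30 also CLOSED the aside 19420 `AsideCasselsTatePairing` (p676333, 2026-08-28T23:26Z:
  `WeierstrassCurve.exists_casselsTate_pairing_holds` discharges the named fact `exists_casselsTate_pairing` for every
  number field).  For THIS crux that re-prices exactly one idea card: `waldspurger-class-parity-two`, whose lever (α)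
  «`#Ш` square ⟹ `ord₂ #Ш` even ⟹ a slack-one lower inequality with even `ord₂ #Ш_an` is already sharp» leaned on the
  binder `hCT : exists_casselsTate_pairing (K := ℚ)`; (F1)/(F2) certify that (α) is now a HYPOTHESIS-FREE kernel step ((F3): on the crux's rank-0 habitat even the
  finiteness of Ш is print inside PUB — GZK — so the conversion runs modulo `OrdPublishedInputsAtTwo` alone),
  so the card's displayed content is its analytic part only ((β) parity constancy of `ord₂ #Ш_an` on Waldspurger
  classes + the slack-one inequality).  NB the print bundle 23764's «Cassels» conjunct is the ISOGENY invariance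
  `WeierstrassCurve.bsdRHS_eq_of_isIsogenous` (item 19567) — a different statement, untouched by 19420.
-/

set_option autoImplicit false

noncomputable section

open Summit.BirchSwinnertonDyer.BirchSwinnertonDyer
open Literature.NumberTheory.EllipticCurves Literature.NumberTheory.EllipticCurves.ModularForms
  Literature.NumberTheory.EllipticCurves.Rank1Residual

namespace Summit.BirchSwinnertonDyer.BirchSwinnertonDyer.Cruxes.OrdMissingLowerBoundAtTwo.TriageR1Seat2Gen19

/-- (A) glue 23765 still closed by p676269 under rev 30. -/
example : Theses.ByReductionTypeAtTwo.OrdMissingLowerBoundAtTwoOfChildren :=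
  Theorems.KatoFreeSandwich.ordMissingLowerBoundAtTwoOfChildren_proof

/-- (A') and its text is still `print bundle → λ-half → crux`. -/
example : Theses.ByReductionTypeAtTwo.OrdMissingLowerBoundAtTwoOfChildren ↔
    (Theses.ByReductionTypeAtTwo.OrdMLBPrintBundleAtTwo → Theses.ByReductionTypeAtTwo.OrdLambdaHalfAtTwo →
      Theses.ByReductionTypeAtTwo.OrdMissingLowerBoundAtTwo) := Iff.rfl

/-- (B) the crux decl is the leaf by name. -/
example : Theses.ByReductionTypeAtTwo.OrdMissingLowerBoundAtTwo ↔
    Theorems.OrdHalvesAtTwo.OrdMissingLowerBoundAtTwo := Iff.rfl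

/-- (C1) K4's child 19556 = the constant the line consumes. -/
example : Theses.ByReductionTypeAtTwo.OrdLambdaHalfAtTwo ↔ Theorems.TwoAdicTwistConverse.OrdLambdaHalfAtTwo := Iff.rfl

/-- (C2) K4's child 19556 = S3's own route decl (the frozen `Theses/TwoAdicConverse.lean`). -/
example : Theses.ByReductionTypeAtTwo.OrdLambdaHalfAtTwo ↔ Theses.TwoAdicConverse.OrdLambdaHalfAtTwo := Iff.rfl

/-- (D) the print bundle 23764 is still the four-way conjunction. -/
example : Theses.ByReductionTypeAtTwo.OrdMLBPrintBundleAtTwo ↔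
    (Literature.Uncategorized.OrdPublishedInputsAtTwo ∧ WeierstrassCurve.bsdRHS_eq_of_isIsogenous ∧
      abbesUllmo_not_dvd_maninConstant_of_not_dvd_level ∧ exists_optimal_gamma1ParametrizationData) := Iff.rfl

/-- (E1) p671201's by-image re-assembly has p668589's exact type. -/
example : (Literature.Uncategorized.OrdPublishedInputsAtTwo → WeierstrassCurve.bsdRHS_eq_of_isIsogenous →
      abbesUllmo_not_dvd_maninConstant_of_not_dvd_level → exists_optimal_gamma1ParametrizationData →
      Theorems.TwoAdicTwistConverse.OrdLambdaHalfAtTwo → Theorems.OrdHalvesAtTwo.OrdMissingLowerBoundAtTwo) :=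
  Theorems.KatoFreeSandwich.ordMissingLowerBoundAtTwo_of_published_of_lambdaHalf_byImage

/-- (E2) same type, the assembled line itself (p668589). -/
example : (Literature.Uncategorized.OrdPublishedInputsAtTwo → WeierstrassCurve.bsdRHS_eq_of_isIsogenous →
      abbesUllmo_not_dvd_maninConstant_of_not_dvd_level → exists_optimal_gamma1ParametrizationData →
      Theorems.TwoAdicTwistConverse.OrdLambdaHalfAtTwo → Theorems.OrdHalvesAtTwo.OrdMissingLowerBoundAtTwo) :=
  Theorems.KatoFreeSandwich.ordMissingLowerBoundAtTwo_of_published_of_lambdaHalf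

/-- (E3) the reducible-branch socket of SUMMON key (c), verbatim: λ-half on the non-CM good-ordinary `E[2]`-reducible
curves closes 19577's reducible quarter modulo PUB ∧ Cassels ∧ AU ∧ T2 (p671201 §3). -/
example (hPub : Literature.Uncategorized.OrdPublishedInputsAtTwo) (hCassels : WeierstrassCurve.bsdRHS_eq_of_isIsogenous)
    (hAU : abbesUllmo_not_dvd_maninConstant_of_not_dvd_level) (hex : exists_optimal_gamma1ParametrizationData)
    (hΛred : ∀ (W : WeierstrassCurve ℚ) [W.IsElliptic] [W.IsGloballyMinimal], ¬ W.HasCM → GoodOrd W 2 →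
      ¬ W.HasIrreducibleModPGaloisRep 2 → Theorems.TwoAdicTwistConverse.LambdaHalfAtTwo W)
    (W : WeierstrassCurve ℚ) [W.IsElliptic] [W.IsGloballyMinimal] (hcm : ¬ W.HasCM) (hr : W.analyticRank = 0)
    (hgo : GoodOrd W 2) (hred : ¬ W.HasIrreducibleModPGaloisRep 2) : Typed.MissingLowerBoundAt W 2 :=
  Theorems.KatoFreeSandwich.missingLowerBoundAt_two_of_red_of_lambdaHalfRed hPub hCassels hAU hex hΛred W hcm hr hgo hred

/-- (E4) the irreducible-branch socket (19556's `stub_irreducibleResidual` shape), per curve, with NO Cassels and NO T2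
(p671201 §2). -/
example (hPub : Literature.Uncategorized.OrdPublishedInputsAtTwo)
    (hAU : abbesUllmo_not_dvd_maninConstant_of_not_dvd_level)
    (hΛirr : ∀ (W : WeierstrassCurve ℚ) [W.IsElliptic] [W.IsGloballyMinimal], ¬ W.HasCM → GoodOrd W 2 →
      W.HasIrreducibleModPGaloisRep 2 → Theorems.TwoAdicTwistConverse.LambdaHalfAtTwo W)
    (W : WeierstrassCurve ℚ) [W.IsElliptic] [W.IsGloballyMinimal] (hcm : ¬ W.HasCM) (hr : W.analyticRank = 0)
    (hgo : GoodOrd W 2) (hirr : W.HasIrreducibleModPGaloisRep 2) : Typed.MissingLowerBoundAt W 2 :=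
  Theorems.KatoFreeSandwich.missingLowerBoundAt_two_of_irr_of_lambdaHalfIrr hPub hAU hΛirr W hcm hr hgo hirr

/-- (F1) `ord₂ #Ш(E/ℚ)` is even for finite `Ш` — now with NO displayed hypothesis (the `hCT` binder of
`Theorems.even_padicValNat_shaOrder_of_casselsTate` is fed by p676333's `exists_casselsTate_pairing_holds`). -/
example (W : WeierstrassCurve ℚ) [W.IsElliptic] (hfin : Finite W.sha) : Even (padicValNat 2 W.shaOrder) :=
  Theorems.even_padicValNat_shaOrder_of_casselsTate WeierstrassCurve.exists_casselsTate_pairing_holds W hfin 2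

/-- (F2) card `waldspurger-class-parity-two`, lever (α), as a hypothesis-free kernel step at one curve: a slack-one lower
inequality `ord₂ #Ш_an ≤ ord₂ #Ш + 1` + `ord₂ #Ш_an` even + `Ш` finite ⟹ the crux's conclusion `MissingLowerBoundAt W 2`.
What stays displayed is exactly the card's analytic content. [folklore] -/
example (W : WeierstrassCurve ℚ) [W.IsElliptic] (hfin : Finite W.sha) (q : ℚ) (hq : shaAn W = (q : ℂ))
    (hle : padicValRat 2 q ≤ (padicValNat 2 W.shaOrder : ℤ) + 1) (hev : Even (padicValRat 2 q)) :
    Typed.MissingLowerBoundAt W 2 := by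
  refine ⟨q, hq, ?_⟩
  obtain ⟨u, hu⟩ := hev
  obtain ⟨v, hv⟩ :=
    Theorems.even_padicValNat_shaOrder_of_casselsTate WeierstrassCurve.exists_casselsTate_pairing_holds W hfin 2
  rw [hv] at hle ⊢
  push_cast at hle ⊢
  omega

/-- (F3) on the crux's own habitat (analytic rank 0) the finiteness input of (F2) is PRINT INSIDE THE BUNDLE: PUB's
Gross–Zagier–Kolyvagin conjunct `rank_eq_analyticRank_of_analyticRank_le_one` gives `Finite W.sha` at analytic rank ≤ 1, so the
module's conversion «DefectOne ∧ (ord₂ #Ш_an even) ⟹ MissingLowerBoundAt W 2» is, curve by curve, a kernel step modulo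
`OrdPublishedInputsAtTwo` ALONE (no Cassels–Tate binder since p676333; no AU, no T2, no isogeny invariance). [folklore] -/
example (hPub : Literature.Uncategorized.OrdPublishedInputsAtTwo)
    (W : WeierstrassCurve ℚ) [W.IsElliptic] (hr : W.analyticRank = 0) (q : ℚ) (hq : shaAn W = (q : ℂ))
    (hle : padicValRat 2 q ≤ (padicValNat 2 W.shaOrder : ℤ) + 1) (hev : Even (padicValRat 2 q)) :
    Typed.MissingLowerBoundAt W 2 := by
  have hfin : Finite W.sha := (hPub.2.1 W (by omega)).2
  refine ⟨q, hq, ?_⟩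
  obtain ⟨u, hu⟩ := hev
  obtain ⟨v, hv⟩ :=
    Theorems.even_padicValNat_shaOrder_of_casselsTate WeierstrassCurve.exists_casselsTate_pairing_holds W hfin 2
  rw [hv] at hle ⊢
  push_cast at hle ⊢
  omega

end Summit.BirchSwinnertonDyer.BirchSwinnertonDyer.Cruxes.OrdMissingLowerBoundAtTwo.TriageR1Seat2Gen19

end
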